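import Summits.AnomalousDissipation.AnomalousDissipation.Theorems.NeutralTaylorWavesNonresonantSelectionKellerAnalysis
import Summits.AnomalousDissipation.AnomalousDissipation.Theorems.NeutralTaylorWavesNonresonantSelectionKellerAlgebra
import HarnessLib

/-!
# The approximate Keller bordering lemma for the linearised steady Navier–Stokes operator on `T³`
# — crux `NeutralTaylorWaves.NonresonantSelection` (stmt-AnomalousDissipation-16294), line `birth`

Composition of the two landed stubs `stub_kellerAnalysis` (analytic half) and `stub_kellerAlgebra`
(real-arithmetic half) of the skeleton `Cruxes/NonresonantSelection/Lines/birth.lean`.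

Setting. Smooth divergence-free base `w : T³ → ℝ³`, drift `c` along `x₃`, viscosity `ν`; the
UNBORDERED linearised steady operator `A(v, r) = w·∇v + v·∇w − νΔv + ∇r − c∂₃v` on test pairs
(smooth divergence-free mean-zero `v`, smooth pressure `r`); the phase direction `φ = ∂₃w`; the BORDERED
operator `(v, r, b) ↦ (A(v, r) − bφ, ⟨v, φ⟩)` and its a-priori bound
`‖v‖₂² + b² ≤ M²(‖A(v,r) − bφ‖₂² + ⟨v, φ⟩²)` (the last clause of the route target, `M = C₀ν^{-K₀}`).

Theorem (`stub_approxKellerBordering`, registered on the crux item under that name). With ONE largeness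
parameter `Λ ≥ 1`: if `Λ⁻¹ ≤ ‖φ‖₂ ≤ Λ`, a smooth `ψ` with `‖ψ‖₂ ≤ 1` has pairing `Λ|⟨ψ, φ⟩| ≥ 1`,
`A` obeys the REDUCED bound `‖u‖₂ ≤ Λ‖A(u, r)‖₂` on test fields `u ⊥ φ`, `φ` is an approximate kernel
vector (`‖A(φ, q₃)‖₂ ≤ ρ`, `ρΛ³ ≤ 1`) and `ψ` an approximate cokernel vector
(`|⟨ψ, A(v, r)⟩| ≤ ρ′‖v‖₂` on the test class, `2ρ′Λ³ ≤ 1`), then the bordered bound holds with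
`M = 10Λ³`. This is Keller's bordering lemma (bordered operators / "ABCD lemma": a Fredholm operator with
one-dimensional kernel `φ` and cokernel `ψ*` bordered by the kernel functional is invertible iff
`⟨φ, ψ*⟩ ≠ 0`) in a-priori-estimate form with approximate kernel and cokernel vectors, which is what a
quasi-steady (not exactly steady) base provides: for an `x₃`-invariant force, `∂₃w` is an all-orders
approximate kernel vector by the translation identity `L(∂₃w, ∂₃q) = ∂₃R`
(`Theorems/NonresonantSelection/Negative/TranslationMode`). In the line it reduces the bordered gap on the
spine to the two spectral quantities of the crux ideas: the reduced injectivity modulus on `φ^⊥` and the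
translation pairing `⟨∂₃w, ψ*⟩` (H. B. Keller's bordering algorithm, 1977; bordered operators as in
Chow–Hale, *Methods of Bifurcation Theory*, §2.4). [cite: ChowHale1982, Sect. 2.4 (bordered operators)]
-/

-- `Summit.<Summit>.<Problem>` is the tree's mandated summit-side namespace; for this single-conjunct
-- summit the two segments coincide, so the duplicate is deliberate.
set_option linter.dupNamespace false

noncomputable section

namespace Summit.AnomalousDissipation.AnomalousDissipation.Theorems

open MeasureTheory
open scoped InnerProductSpace
open Literature.Analysis.FunctionSpaces

/-- **Approximate Keller bordering lemma on `T³`** (registered stub `stub_approxKellerBordering` of line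
`birth`; composition of `stub_kellerAnalysis` and `stub_kellerAlgebra`). At a smooth divergence-free base
`(w, c)`, viscosity `ν`: if, for one largeness parameter `Λ ≥ 1`, `Λ⁻¹ ≤ ‖∂₃w‖₂ ≤ Λ`, a smooth `ψ` with
`‖ψ‖₂ ≤ 1` pairs with the phase direction, `Λ|⟨ψ, ∂₃w⟩| ≥ 1`, the unbordered operator
`A(v, r) = w·∇v + v·∇w − νΔv + ∇r − c∂₃v` has the reduced bound `‖u‖₂ ≤ Λ‖A(u, r)‖₂` on test fields
`u ⊥ ∂₃w`, `∂₃w` is an approximate kernel vector (`‖A(∂₃w, q₃)‖₂ ≤ ρ`, `ρΛ³ ≤ 1`) and `ψ` an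
approximate cokernel vector (`|⟨ψ, A(v, r)⟩| ≤ ρ′‖v‖₂`, `2ρ′Λ³ ≤ 1`), then the BORDERED a-priori bound
`‖v‖₂² + b² ≤ (10Λ³)²(‖A(v, r) − b∂₃w‖₂² + ⟨v, ∂₃w⟩²)` holds for every test triple `(v, r, b)`.
[cite: ChowHale1982, Sect. 2.4 (bordered operators)] -/
theorem stub_approxKellerBordering :
    ∀ (ν c Λ ρ ρ' : ℝ) (w ψ : UnitAddTorus (Fin 3) → EuclideanSpace ℝ (Fin 3))
      (q₃ : UnitAddTorus (Fin 3) → ℝ),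
      1 ≤ Λ → 0 ≤ ρ → 0 ≤ ρ' → ρ * Λ ^ 3 ≤ 1 → 2 * ρ' * Λ ^ 3 ≤ 1 →
      Torus.IsSmooth w → Torus.IsDivFree w → Torus.IsSmooth ψ → Torus.IsSmooth q₃ →
      (∫ x, ‖ψ x‖ ^ 2) ≤ 1 →
      Real.sqrt (∫ x, ‖Torus.partialDeriv (2 : Fin 3) w x‖ ^ 2) ≤ Λ →
      1 ≤ Λ * Real.sqrt (∫ x, ‖Torus.partialDeriv (2 : Fin 3) w x‖ ^ 2) →
      1 ≤ Λ * |∫ x, inner ℝ (ψ x) (Torus.partialDeriv (2 : Fin 3) w x)| →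
      Real.sqrt (∫ x, ‖Torus.convect w (Torus.partialDeriv (2 : Fin 3) w) x +
          Torus.convect (Torus.partialDeriv (2 : Fin 3) w) w x -
          ν • Torus.laplacian (Torus.partialDeriv (2 : Fin 3) w) x + Torus.gradient q₃ x -
          c • Torus.partialDeriv (2 : Fin 3) (Torus.partialDeriv (2 : Fin 3) w) x‖ ^ 2) ≤ ρ →
      (∀ (v' : UnitAddTorus (Fin 3) → EuclideanSpace ℝ (Fin 3)) (r' : UnitAddTorus (Fin 3) → ℝ),
        Torus.IsSmooth v' → Torus.IsSmooth r' → Torus.IsDivFree v' → Torus.HasZeroMean v' →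
        |∫ x, inner ℝ (ψ x) (Torus.convect w v' x + Torus.convect v' w x - ν • Torus.laplacian v' x +
            Torus.gradient r' x - c • Torus.partialDeriv (2 : Fin 3) v' x)| ≤
          ρ' * Real.sqrt (∫ x, ‖v' x‖ ^ 2)) →
      (∀ (u : UnitAddTorus (Fin 3) → EuclideanSpace ℝ (Fin 3)) (r' : UnitAddTorus (Fin 3) → ℝ),
        Torus.IsSmooth u → Torus.IsSmooth r' → Torus.IsDivFree u → Torus.HasZeroMean u →
        (∫ x, inner ℝ (u x) (Torus.partialDeriv (2 : Fin 3) w x)) = 0 →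
        Real.sqrt (∫ x, ‖u x‖ ^ 2) ≤
          Λ * Real.sqrt (∫ x, ‖Torus.convect w u x + Torus.convect u w x - ν • Torus.laplacian u x +
            Torus.gradient r' x - c • Torus.partialDeriv (2 : Fin 3) u x‖ ^ 2)) →
      ∀ (v : UnitAddTorus (Fin 3) → EuclideanSpace ℝ (Fin 3)) (r : UnitAddTorus (Fin 3) → ℝ) (b : ℝ),
        Torus.IsSmooth v → Torus.IsSmooth r → Torus.IsDivFree v → Torus.HasZeroMean v →
        (∫ x, ‖v x‖ ^ 2) + b ^ 2 ≤
          (10 * Λ ^ 3) ^ 2 * ((∫ x, ‖Torus.convect w v x + Torus.convect v w x - ν • Torus.laplacian v x +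
              Torus.gradient r x - c • Torus.partialDeriv (2 : Fin 3) v x -
              b • Torus.partialDeriv (2 : Fin 3) w x‖ ^ 2) +
            (∫ x, inner ℝ (v x) (Torus.partialDeriv (2 : Fin 3) w x)) ^ 2) := by
  intro ν c Λ ρ ρ' w ψ q₃ hΛ hρ hρ' hρΛ hρ'Λ hw hwdiv hψ hq₃ hψ1 hΦle hΦge hpair hker hcoker hgap v r b
    hv hr hvdiv hvmean
  -- names for the real quantities
  set I : ℝ := ∫ x, ‖Torus.partialDeriv (2 : Fin 3) w x‖ ^ 2 with hI_def
  set Φ : ℝ := Real.sqrt I with hΦ_def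
  set Bd : ℝ := ∫ x, inner ℝ (v x) (Torus.partialDeriv (2 : Fin 3) w x) with hBd_def
  set V : ℝ := Real.sqrt (∫ x, ‖v x‖ ^ 2) with hV_def
  set U : ℝ := Real.sqrt (∫ x, ‖v x - (Bd / I) • Torus.partialDeriv (2 : Fin 3) w x‖ ^ 2) with hU_def
  set Fn : ℝ := Real.sqrt (∫ x, ‖Torus.convect w v x + Torus.convect v w x - ν • Torus.laplacian v x +
      Torus.gradient r x - c • Torus.partialDeriv (2 : Fin 3) v x -
      b • Torus.partialDeriv (2 : Fin 3) w x‖ ^ 2) with hFn_def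
  set Pr : ℝ := |∫ x, inner ℝ (ψ x) (Torus.partialDeriv (2 : Fin 3) w x)| with hPr_def
  have hΛ0 : 0 ≤ Λ := zero_le_one.trans hΛ
  have hI0 : 0 ≤ I := integral_nonneg fun x => by positivity
  have hΦpos : 0 < Φ := by
    rcases (Real.sqrt_nonneg I).eq_or_lt with h | h
    · exfalso
      have : (1 : ℝ) ≤ 0 := by simpa [hΦ_def, ← h] using hΦge
      linarith
    · exact h
  have hIpos : 0 < I := by
    by_contra h
    have hI : I = 0 := le_antisymm (not_lt.1 h) hI0
    have : Φ = 0 := by rw [hΦ_def, hI, Real.sqrt_zero]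
    linarith
  have hΦ2 : Φ ^ 2 = I := Real.sq_sqrt hI0
  -- the analytic half
  obtain ⟨h1, h2, h3⟩ := stub_kellerAnalysis ν c b Λ ρ ρ' w ψ v q₃ r hΛ0 hw hwdiv hψ hq₃ hv hvdiv hvmean
    hr hIpos hψ1 hgap hker hcoker
  -- the algebraic half
  have hV0 : 0 ≤ V := Real.sqrt_nonneg _
  have hU0 : 0 ≤ U := Real.sqrt_nonneg _
  have hFn0 : 0 ≤ Fn := Real.sqrt_nonneg _
  have h1' : V ≤ U + |Bd / Φ ^ 2| * Φ := by rw [hΦ2]; exact h1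
  have h2' : U ≤ Λ * (Fn + |b| * Φ + |Bd / Φ ^ 2| * ρ) := by rw [hΦ2]; exact h2
  have key := stub_kellerAlgebra Λ ρ ρ' V U Φ Fn b Bd Pr hΛ hρ hρ' hρΛ hρ'Λ hV0 hU0 hFn0 hΦpos hΦle
    hΦge hpair h1' h2' h3
  have hV2 : V ^ 2 = ∫ x, ‖v x‖ ^ 2 := Real.sq_sqrt (integral_nonneg fun x => by positivity)
  have hFn2 : Fn ^ 2 = ∫ x, ‖Torus.convect w v x + Torus.convect v w x - ν • Torus.laplacian v x +
      Torus.gradient r x - c • Torus.partialDeriv (2 : Fin 3) v x -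
      b • Torus.partialDeriv (2 : Fin 3) w x‖ ^ 2 := Real.sq_sqrt (integral_nonneg fun x => by positivity)
  rw [hV2, hFn2] at key
  exact key

end Summit.AnomalousDissipation.AnomalousDissipation.Theorems

end
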